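import Mathlib
import Literature.MathematicalPhysics.QuantumFieldTheory.Luscher2010.TrivializingMaps
import Literature.MathematicalPhysics.QuantumFieldTheory.Luscher2010.FlowActionSeries
import Literature.MathematicalPhysics.QuantumFieldTheory.SUNBakryEmeryPoincare
import Summits.Ventures.LatticeQCDFlow.TrivializingMaps.TruncationDefect
import Summits.Ventures.LatticeQCDFlow.TrivializingMaps.HaarByPartsZeroModes
import HarnessLib

/-!
# Link polynomials: finite-dimensional spaces of lattice functionals stable under `∂^a_{x,μ}` and `Δ`

HONEST FRAMING: exact (Metropolis-corrected) sampling algorithms for lattice gauge theory; figures of merit are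
autocorrelation/cost numbers at stated couplings and volumes; no continuum-physics claim.

Lüscher, CMP 293 (2010) 899, §4.4 (after eq. (4.22)): "Since `Δ` maps any polynomial in `W₀, W₁, …` into another
polynomial in these variables, it is possible to work out the expansion (4.20)"; App. A eq. (A.3): `∂^a_{x,μ}` acts by left
multiplication with generators. This file is the finite-dimensional bookkeeping behind that remark on the AMBIENT space
`M_n(ℂ)^E` of the tree's `linkDeriv`/`linkLap`: `lcoord (e, κ)` = the real coordinates `Re/Im W(e)_{ab}`; `lmonom` = their
monomials; `polyL d L n m` = span of monomials of degree `≤ m` (finite-dimensional), stable under every `∂_{e,X}`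
(`linkDeriv_mem_polyL`, Leibniz + `linkDeriv_lcoord_of_eq`), under `Δ` (`linkLap_mem_polyL`) and graded under products;
`depOn A` = functionals depending only on the links of `A ⊆ E` (stable under `∂`, `Δ`, products; `∂_{e,X} = 0` for
`e ∉ A`, `linkDeriv_eq_zero_of_not_mem`); `PD m A = polyL m ⊓ depOn A`. Used by `PoissonSolver`/`LuscherSeriesExistence`;
mirrors `SUNBakryEmery.polySpace`. Reference: [Luscher2010Trivializing, arXiv:0907.5491], §4.4, App. A eqs. (A.1)–(A.6).
-/

namespace Summit.Ventures.LatticeQCDFlow.TrivializingMaps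

open Literature.MathematicalPhysics.QuantumFieldTheory
open Literature.MathematicalPhysics.QuantumFieldTheory.Luscher2010
open scoped Matrix Matrix.Norms.Frobenius ContDiff

noncomputable section

variable {d L n : ℕ} [NeZero L]
/-! ## §1. Link coordinates, link monomials, the spaces `polyL m` -/
/-- Index of a real coordinate of the ambient configuration space: a link and a real coordinate of
`M_n(ℂ)`. [folklore] -/
abbrev LinkCoord (d L n : ℕ) : Type := Edge d L × SUNBakryEmery.CoordIdx n

/-- The real coordinate functions `W ↦ Re W(e)_{ab}`, `W ↦ Im W(e)_{ab}` (as `Re tr(W(e) M_κ)`). [folklore] -/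
def lcoord (κ : LinkCoord d L n) : AmbConfig d L n → ℝ := fun W => SUNBakryEmery.coordFn κ.2 (W κ.1)

/-- A link coordinate as a continuous linear functional. [folklore] -/
def lcoordCLM (κ : LinkCoord d L n) : AmbConfig d L n →L[ℝ] ℝ :=
  (SUNBakryEmery.reTrMul (SUNBakryEmery.coordMat κ.2)).comp
    (ContinuousLinearMap.proj (R := ℝ) (φ := fun _ : Edge d L => Matrix (Fin n) (Fin n) ℂ) κ.1)

omit [NeZero L] in
/-- `lcoordCLM` is `lcoord` as a function. [folklore] -/
theorem coe_lcoordCLM (κ : LinkCoord d L n) : ⇑(lcoordCLM κ) = lcoord κ := rfl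

/-- Link coordinates are smooth. [folklore] -/
theorem contDiff_lcoord (κ : LinkCoord d L n) : ContDiff ℝ ∞ (lcoord κ) := by
  rw [← coe_lcoordCLM]; exact (lcoordCLM κ).contDiff

/-- The link monomial `∏ᵢ lcoord (κs i)`. [folklore] -/
def lmonom {k : ℕ} (κs : Fin k → LinkCoord d L n) : AmbConfig d L n → ℝ := fun W => ∏ i, lcoord (κs i) W

/-- Link monomials are smooth. [folklore] -/
theorem contDiff_lmonom {k : ℕ} (κs : Fin k → LinkCoord d L n) : ContDiff ℝ ∞ (lmonom κs) := by
  show ContDiff ℝ ∞ fun W => ∏ i, lcoord (κs i) W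
  exact contDiff_prod fun i _ => contDiff_lcoord (κs i)

/-- **`polyL m`**: the real span of the link monomials of degree `≤ m` (Lüscher's "polynomials in the link
variables", §4.4, in real coordinates). [cite: Luscher2010Trivializing, §4.4] -/
def polyL (d L n m : ℕ) : Submodule ℝ (AmbConfig d L n → ℝ) :=
  Submodule.span ℝ (Set.range fun p : (Σ k : Fin (m + 1), (Fin k → LinkCoord d L n)) => lmonom p.2)

/-- `polyL m` is finite-dimensional (finitely many monomials on a finite lattice). [folklore] -/
instance polyL.finiteDimensional (m : ℕ) : FiniteDimensional ℝ (polyL d L n m) :=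
  FiniteDimensional.span_of_finite ℝ (Set.finite_range _)

omit [NeZero L] in
/-- Monomials of degree `k ≤ m` lie in `polyL m`. [folklore] -/
theorem lmonom_mem {m k : ℕ} (hk : k ≤ m) (κs : Fin k → LinkCoord d L n) : lmonom κs ∈ polyL d L n m :=
  Submodule.subset_span ⟨⟨⟨k, Nat.lt_succ_of_le hk⟩, κs⟩, rfl⟩

omit [NeZero L] in
/-- `polyL` is monotone in the degree. [folklore] -/
theorem polyL_mono {m m' : ℕ} (h : m ≤ m') : polyL d L n m ≤ polyL d L n m' := by
  refine Submodule.span_le.2 ?_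
  rintro _ ⟨⟨k, κs⟩, rfl⟩
  exact lmonom_mem ((Nat.lt_succ_iff.1 k.2).trans h) κs

omit [NeZero L] in
/-- `1 ∈ polyL m`. [folklore] -/
theorem one_mem_polyL (m : ℕ) : (fun _ : AmbConfig d L n => (1 : ℝ)) ∈ polyL d L n m := by
  have h := lmonom_mem (d := d) (L := L) (n := n) (m := m) (Nat.zero_le m)
    (Fin.elim0 : Fin 0 → LinkCoord d L n)
  have e : lmonom (Fin.elim0 : Fin 0 → LinkCoord d L n) = fun _ => (1 : ℝ) := by
    funext W; simp [lmonom]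
  rwa [e] at h

omit [NeZero L] in
/-- Constants lie in `polyL m`. [folklore] -/
theorem const_mem_polyL (m : ℕ) (c : ℝ) : (fun _ : AmbConfig d L n => c) ∈ polyL d L n m := by
  have : (fun _ : AmbConfig d L n => c) = c • fun _ : AmbConfig d L n => (1 : ℝ) := by
    funext W; simp
  rw [this]
  exact Submodule.smul_mem _ c (one_mem_polyL m)

omit [NeZero L] in
/-- Coordinates lie in `polyL m`, `m ≥ 1`. [folklore] -/
theorem lcoord_mem_polyL {m : ℕ} (hm : 1 ≤ m) (κ : LinkCoord d L n) : lcoord κ ∈ polyL d L n m := by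
  have h := lmonom_mem (m := m) hm (fun _ : Fin 1 => κ)
  have e : lmonom (fun _ : Fin 1 => κ) = lcoord κ := by
    funext W; simp [lmonom]
  rwa [e] at h

/-- Members of `polyL m` are smooth. [folklore] -/
theorem contDiff_of_mem_polyL {m : ℕ} {f : AmbConfig d L n → ℝ} (hf : f ∈ polyL d L n m) :
    ContDiff ℝ ∞ f := by
  induction hf using Submodule.span_induction with
  | mem x hx =>
      obtain ⟨⟨k, κs⟩, rfl⟩ := hx
      exact contDiff_lmonom κs
  | zero => exact contDiff_const
  | add x y _ _ hx hy => exact hx.add hy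
  | smul c x _ hx => exact hx.const_smul c

omit [NeZero L] in
/-- Products of link monomials are link monomials. [folklore] -/
theorem lmonom_mul_lmonom {k k' : ℕ} (κs : Fin k → LinkCoord d L n) (κs' : Fin k' → LinkCoord d L n) :
    lmonom κs * lmonom κs' = lmonom (Fin.append κs κs') := by
  funext W
  simp only [Pi.mul_apply, lmonom, Fin.prod_univ_add, Fin.append_left, Fin.append_right]

omit [NeZero L] in
/-- **`polyL a · polyL b ⊆ polyL (a + b)`**. [folklore] -/
theorem mul_mem_polyL {a b : ℕ} {f g : AmbConfig d L n → ℝ} (hf : f ∈ polyL d L n a)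
    (hg : g ∈ polyL d L n b) : f * g ∈ polyL d L n (a + b) := by
  induction hf using Submodule.span_induction with
  | mem x hx =>
      obtain ⟨⟨k, κs⟩, rfl⟩ := hx
      induction hg using Submodule.span_induction with
      | mem y hy =>
          obtain ⟨⟨k', κs'⟩, rfl⟩ := hy
          rw [lmonom_mul_lmonom]
          exact lmonom_mem (Nat.add_le_add (Nat.lt_succ_iff.1 k.2) (Nat.lt_succ_iff.1 k'.2)) _
      | zero => rw [mul_zero]; exact Submodule.zero_mem _
      | add y z _ _ hy hz => rw [mul_add]; exact Submodule.add_mem _ hy hz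
      | smul c y _ hy => rw [mul_smul_comm]; exact Submodule.smul_mem _ c hy
  | zero => rw [zero_mul]; exact Submodule.zero_mem _
  | add x y _ _ hx hy => rw [add_mul]; exact Submodule.add_mem _ hx hy
  | smul c x _ hx => rw [smul_mul_assoc]; exact Submodule.smul_mem _ c hx

omit [NeZero L] in
/-- Degree-bounded products. [folklore] -/
theorem mul_mem_polyL_of_le {a b m : ℕ} (h : a + b ≤ m) {f g : AmbConfig d L n → ℝ}
    (hf : f ∈ polyL d L n a) (hg : g ∈ polyL d L n b) : f * g ∈ polyL d L n m :=
  polyL_mono h (mul_mem_polyL hf hg)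
/-! ## §2. `∂_{e,X}` and `Δ` preserve `polyL m` -/
/-- **`∂_{e,X}` of a link coordinate** (eq. (A.3): left multiplication of `W(e)` by `X`):
`∂_{e,X} [Re tr(W(e') M)] = δ_{e e'} Re tr(X W(e) M)`. [cite: Luscher2010Trivializing, App. A eq. (A.3)] -/
theorem linkDeriv_lcoord (e : Edge d L) (X : Matrix (Fin n) (Fin n) ℂ) (κ : LinkCoord d L n)
    (W : AmbConfig d L n) :
    linkDeriv e X (lcoord κ) W =
      ((Pi.single e (X * W e) : AmbConfig d L n) κ.1 * SUNBakryEmery.coordMat κ.2).trace.re := by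
  rw [linkDeriv_eq_fderiv ((contDiff_lcoord κ).differentiable (by simp) W), ← coe_lcoordCLM,
    ContinuousLinearMap.fderiv]
  rfl

/-- `∂_{e,X}` kills the coordinates of the other links. [folklore] -/
theorem linkDeriv_lcoord_of_ne {e : Edge d L} (X : Matrix (Fin n) (Fin n) ℂ) {κ : LinkCoord d L n}
    (h : κ.1 ≠ e) : linkDeriv e X (lcoord κ) = fun _ => 0 := by
  funext W
  rw [linkDeriv_lcoord]
  simp [Pi.single_eq_of_ne h]

/-- On its own link, `∂_{e,X}` maps a coordinate to the linear function `W ↦ Re tr(W(e) (M_κ X))`. [folklore] -/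
theorem linkDeriv_lcoord_of_eq {e : Edge d L} (X : Matrix (Fin n) (Fin n) ℂ) {κ : LinkCoord d L n}
    (h : κ.1 = e) :
    linkDeriv e X (lcoord κ) = fun W => (W e * (SUNBakryEmery.coordMat κ.2 * X)).trace.re := by
  funext W
  rw [linkDeriv_lcoord, h, Pi.single_eq_same, Matrix.mul_assoc, Matrix.trace_mul_comm, Matrix.mul_assoc]

/-- Lifting a one-matrix functional to the link `e`: `f ↦ (W ↦ f (W e))`. [folklore] -/
def liftAt (e : Edge d L) : (Matrix (Fin n) (Fin n) ℂ → ℝ) →ₗ[ℝ] (AmbConfig d L n → ℝ) where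
  toFun f W := f (W e)
  map_add' _ _ := rfl
  map_smul' _ _ := rfl

omit [NeZero L] in
/-- Linear functions of one link lie in the span of the link coordinates. [folklore] -/
theorem reTrMul_link_mem_span (e : Edge d L) (M : Matrix (Fin n) (Fin n) ℂ) :
    (fun W : AmbConfig d L n => (W e * M).trace.re) ∈
      Submodule.span ℝ (Set.range (lcoord (d := d) (L := L) (n := n))) := by
  have h := Submodule.mem_map_of_mem (f := liftAt (d := d) (L := L) e)
    (SUNBakryEmery.reTrMul_mem_span_coordFn M)
  rw [Submodule.map_span] at h
  refine Submodule.span_mono ?_ h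
  rintro _ ⟨_, ⟨κ, rfl⟩, rfl⟩
  exact ⟨(e, κ), rfl⟩

/-- `∂_{e,X}` maps link coordinates into the span of the link coordinates. [folklore] -/
theorem linkDeriv_lcoord_mem_span (e : Edge d L) (X : Matrix (Fin n) (Fin n) ℂ) (κ : LinkCoord d L n) :
    linkDeriv e X (lcoord κ) ∈ Submodule.span ℝ (Set.range (lcoord (d := d) (L := L) (n := n))) := by
  by_cases h : κ.1 = e
  · rw [linkDeriv_lcoord_of_eq X h]; exact reTrMul_link_mem_span e _
  · rw [linkDeriv_lcoord_of_ne X h]; exact Submodule.zero_mem _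

omit [NeZero L] in
/-- The span of the link coordinates lies in `polyL 1`. [folklore] -/
theorem span_lcoord_le_polyL :
    Submodule.span ℝ (Set.range (lcoord (d := d) (L := L) (n := n))) ≤ polyL d L n 1 := by
  refine Submodule.span_le.2 ?_
  rintro _ ⟨κ, rfl⟩
  exact lcoord_mem_polyL le_rfl κ

/-- **`∂_{e,X}` of a degree-`k` link monomial is a link polynomial of degree `≤ k`** (Leibniz rule,
eq. (A.3): a left-invariant derivative maps coordinates to linear functions of the same link).
[cite: Luscher2010Trivializing, App. A eq. (A.3)] -/
theorem linkDeriv_lmonom_mem (e : Edge d L) (X : Matrix (Fin n) (Fin n) ℂ) :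
    ∀ {k : ℕ} (κs : Fin k → LinkCoord d L n), linkDeriv e X (lmonom κs) ∈ polyL d L n k
  | 0, κs => by
      have h1 : lmonom κs = fun _ => (1 : ℝ) := by
        funext W; simp [lmonom]
      have h0 : linkDeriv e X (fun _ : AmbConfig d L n => (1 : ℝ)) = 0 := by
        funext W; simp only [linkDeriv, deriv_const, Pi.zero_apply]
      rw [h1, h0]
      exact Submodule.zero_mem _
  | k + 1, κs => by
      have hsplit : lmonom κs = fun W => lcoord (κs 0) W * lmonom (Fin.tail κs) W := by
        funext W; simp only [lmonom, Fin.prod_univ_succ, Fin.tail]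
      have hprod : linkDeriv e X (lmonom κs) =
          linkDeriv e X (lcoord (κs 0)) * lmonom (Fin.tail κs) +
            lcoord (κs 0) * linkDeriv e X (lmonom (Fin.tail κs)) := by
        funext W
        rw [hsplit]
        exact linkDeriv_mul_of_differentiableAt e X ((contDiff_lcoord _).differentiable (by simp) W)
          ((contDiff_lmonom _).differentiable (by simp) W)
      rw [hprod]
      refine Submodule.add_mem _ ?_ ?_
      · exact mul_mem_polyL_of_le (a := 1) (b := k) (by omega)
          (span_lcoord_le_polyL (linkDeriv_lcoord_mem_span e X _)) (lmonom_mem le_rfl _)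
      · exact mul_mem_polyL_of_le (a := 1) (b := k) (by omega) (lcoord_mem_polyL le_rfl _)
          (linkDeriv_lmonom_mem e X _)

/-- **`polyL m` is stable under every link derivative `∂_{e,X}`.** [cite: Luscher2010Trivializing, §4.4] -/
theorem linkDeriv_mem_polyL (e : Edge d L) (X : Matrix (Fin n) (Fin n) ℂ) {m : ℕ}
    {f : AmbConfig d L n → ℝ} (hf : f ∈ polyL d L n m) : linkDeriv e X f ∈ polyL d L n m := by
  suffices h : ContDiff ℝ ∞ f ∧ linkDeriv e X f ∈ polyL d L n m from h.2
  induction hf using Submodule.span_induction with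
  | mem x hx =>
      obtain ⟨⟨k, κs⟩, rfl⟩ := hx
      exact ⟨contDiff_lmonom κs, polyL_mono (Nat.lt_succ_iff.1 k.2) (linkDeriv_lmonom_mem e X κs)⟩
  | zero =>
      refine ⟨contDiff_const, ?_⟩
      have h0 : linkDeriv e X (0 : AmbConfig d L n → ℝ) = 0 := by
        funext W; simp only [linkDeriv, Pi.zero_apply, deriv_const]
      rw [h0]; exact Submodule.zero_mem _
  | add x y _ _ hx hy =>
      refine ⟨hx.1.add hy.1, ?_⟩
      have : linkDeriv e X (x + y) = linkDeriv e X x + linkDeriv e X y := by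
        funext W
        exact linkDeriv_add_of_differentiableAt e X (hx.1.differentiable (by simp) W)
          (hy.1.differentiable (by simp) W)
      rw [this]; exact Submodule.add_mem _ hx.2 hy.2
  | smul c x _ hx =>
      refine ⟨hx.1.const_smul c, ?_⟩
      have : linkDeriv e X (c • x) = c • linkDeriv e X x := by
        funext W; exact linkDeriv_const_mul' e X c x W
      rw [this]; exact Submodule.smul_mem _ c hx.2

/-- **`polyL m` is stable under Lüscher's Laplacian `Δ`** (§4.4: "`Δ` maps any polynomial … into another
polynomial"). [cite: Luscher2010Trivializing, §4.4] -/
theorem linkLap_mem_polyL (B : SuBasis n) {m : ℕ} {f : AmbConfig d L n → ℝ} (hf : f ∈ polyL d L n m) :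
    linkLap B f ∈ polyL d L n m := by
  have h : linkLap B f = -∑ e : Edge d L, ∑ a : B.ι, linkDeriv e (B.T a) (linkDeriv e (B.T a) f) := by
    funext W; simp only [linkLap, Pi.neg_apply, Finset.sum_apply]
  rw [h]
  exact Submodule.neg_mem _ (Submodule.sum_mem _ fun e _ => Submodule.sum_mem _ fun a _ =>
    linkDeriv_mem_polyL e _ (linkDeriv_mem_polyL e _ hf))
/-! ## §3. Functionals depending on a set of links -/
/-- The functionals depending only on the links in `A`, as a submodule. [folklore] -/
def depOn (A : Set (Edge d L)) : Submodule ℝ (AmbConfig d L n → ℝ) where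
  carrier := {f | DependsOn f A}
  add_mem' {f g} hf hg := fun W W' h => by
    show f W + g W = f W' + g W'
    rw [hf h, hg h]
  zero_mem' := fun W W' _ => rfl
  smul_mem' c {f} hf := fun W W' h => by
    show c • f W = c • f W'
    rw [hf h]

omit [NeZero L] in
/-- Membership in `depOn A` is `DependsOn · A`. [folklore] -/
theorem mem_depOn {A : Set (Edge d L)} {f : AmbConfig d L n → ℝ} : f ∈ depOn A ↔ DependsOn f A := Iff.rfl

omit [NeZero L] in
/-- `depOn` is monotone in the link set. [folklore] -/
theorem depOn_mono {A A' : Set (Edge d L)} (h : A ⊆ A') : depOn (n := n) A ≤ depOn A' :=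
  fun _ hf _ _ hW => hf fun i hi => hW i (h hi)

omit [NeZero L] in
/-- A link coordinate of a link in `A` depends only on `A`. [folklore] -/
theorem lcoord_mem_depOn {A : Set (Edge d L)} {κ : LinkCoord d L n} (h : κ.1 ∈ A) : lcoord κ ∈ depOn A :=
  fun W W' hW => by simp only [lcoord, hW _ h]

omit [NeZero L] in
/-- Constants depend on no link. [folklore] -/
theorem const_mem_depOn (A : Set (Edge d L)) (c : ℝ) : (fun _ : AmbConfig d L n => c) ∈ depOn A :=
  fun _ _ _ => rfl

omit [NeZero L] in
/-- `depOn A` is closed under products. [folklore] -/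
theorem mul_mem_depOn {A : Set (Edge d L)} {f g : AmbConfig d L n → ℝ} (hf : f ∈ depOn A)
    (hg : g ∈ depOn A) : f * g ∈ depOn A := fun W W' hW => by
  show f W * g W = f W' * g W'
  rw [hf hW, hg hW]

omit [NeZero L] in
/-- **Link derivatives preserve the dependence set** (the link curve at `e` moves only `W(e)`, by the same
group element). [cite: Luscher2010Trivializing, App. A eq. (A.3)] -/
theorem linkDeriv_mem_depOn (e : Edge d L) (X : Matrix (Fin n) (Fin n) ℂ) {A : Set (Edge d L)}
    {f : AmbConfig d L n → ℝ} (hf : f ∈ depOn A) : linkDeriv e X f ∈ depOn A := by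
  intro W W' hW
  unfold linkDeriv
  congr 1
  funext s
  apply hf
  intro i hi
  by_cases hie : i = e
  · subst hie; simp [hW i hi]
  · simp [Function.update_of_ne hie, hW i hi]

omit [NeZero L] in
/-- **`∂_{e,X} f = 0` if `f` does not depend on the link `e`.** [folklore] -/
theorem linkDeriv_eq_zero_of_not_mem {e : Edge d L} (X : Matrix (Fin n) (Fin n) ℂ) {A : Set (Edge d L)}
    {f : AmbConfig d L n → ℝ} (hf : f ∈ depOn A) (he : e ∉ A) : linkDeriv e X f = fun _ => 0 := by
  funext W
  unfold linkDeriv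
  have h : (fun s : ℝ => f (Function.update W e (NormedSpace.exp ((s : ℂ) • X) * W e))) = fun _ => f W := by
    funext s
    apply hf
    intro i hi
    rw [Function.update_of_ne (ne_of_mem_of_not_mem hi he)]
  rw [h, deriv_const]

/-- `Δ` preserves the dependence set. [folklore] -/
theorem linkLap_mem_depOn (B : SuBasis n) {A : Set (Edge d L)} {f : AmbConfig d L n → ℝ}
    (hf : f ∈ depOn A) : linkLap B f ∈ depOn A := by
  have h : linkLap B f = -∑ e : Edge d L, ∑ a : B.ι, linkDeriv e (B.T a) (linkDeriv e (B.T a) f) := by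
    funext W; simp only [linkLap, Pi.neg_apply, Finset.sum_apply]
  rw [h]
  exact Submodule.neg_mem _ (Submodule.sum_mem _ fun e _ => Submodule.sum_mem _ fun a _ =>
    linkDeriv_mem_depOn e _ (linkDeriv_mem_depOn e _ hf))
/-! ## §4. The spaces `PD m A = polyL m ⊓ depOn A` used by the recursion -/
/-- Link polynomials of degree `≤ m` depending only on the links in `A`. [folklore] -/
def PD (m : ℕ) (A : Set (Edge d L)) : Submodule ℝ (AmbConfig d L n → ℝ) := polyL d L n m ⊓ depOn A

omit [NeZero L] in
/-- Membership in `PD m A`: degree `≤ m`, depends only on the links of `A`. [folklore] -/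
theorem mem_PD {m : ℕ} {A : Set (Edge d L)} {f : AmbConfig d L n → ℝ} :
    f ∈ PD m A ↔ f ∈ polyL d L n m ∧ DependsOn f A := Iff.rfl
/-- `PD m A` is finite-dimensional (a subspace of `polyL m`). [folklore] -/
instance PD.finiteDimensional (m : ℕ) (A : Set (Edge d L)) :
    FiniteDimensional ℝ (PD (n := n) m A) := by
  unfold PD; infer_instance

omit [NeZero L] in
/-- `PD` is monotone in the degree and in the link set. [folklore] -/
theorem PD_mono {m m' : ℕ} {A A' : Set (Edge d L)} (hm : m ≤ m') (hA : A ⊆ A') :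
    PD (n := n) m A ≤ PD m' A' :=
  inf_le_inf (polyL_mono hm) (depOn_mono hA)
/-- Members of `PD m A` are smooth. [folklore] -/
theorem contDiff_of_mem_PD {m : ℕ} {A : Set (Edge d L)} {f : AmbConfig d L n → ℝ} (hf : f ∈ PD m A) :
    ContDiff ℝ ∞ f := contDiff_of_mem_polyL hf.1
omit [NeZero L] in
/-- Constants lie in every `PD m A`. [folklore] -/
theorem const_mem_PD (m : ℕ) (A : Set (Edge d L)) (c : ℝ) : (fun _ : AmbConfig d L n => c) ∈ PD m A :=
  ⟨const_mem_polyL m c, const_mem_depOn A c⟩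

omit [NeZero L] in
/-- Link coordinates of links of `A` lie in `PD m A` for `1 ≤ m`. [folklore] -/
theorem lcoord_mem_PD {m : ℕ} (hm : 1 ≤ m) {A : Set (Edge d L)} {κ : LinkCoord d L n} (h : κ.1 ∈ A) :
    lcoord κ ∈ PD m A :=
  ⟨lcoord_mem_polyL hm κ, lcoord_mem_depOn h⟩

omit [NeZero L] in
/-- `PD` is graded under products (`a + b ≤ c`). [folklore] -/
theorem mul_mem_PD {a b c : ℕ} (h : a + b ≤ c) {A : Set (Edge d L)} {f g : AmbConfig d L n → ℝ}
    (hf : f ∈ PD a A) (hg : g ∈ PD b A) : f * g ∈ PD c A :=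
  ⟨mul_mem_polyL_of_le h hf.1 hg.1, mul_mem_depOn hf.2 hg.2⟩

/-- `PD m A` is stable under link derivatives. [folklore] -/
theorem linkDeriv_mem_PD (e : Edge d L) (X : Matrix (Fin n) (Fin n) ℂ) {m : ℕ} {A : Set (Edge d L)}
    {f : AmbConfig d L n → ℝ} (hf : f ∈ PD m A) : linkDeriv e X f ∈ PD m A :=
  ⟨linkDeriv_mem_polyL e X hf.1, linkDeriv_mem_depOn e X hf.2⟩

/-- `PD m A` is stable under the link Laplacian. [folklore] -/
theorem linkLap_mem_PD (B : SuBasis n) {m : ℕ} {A : Set (Edge d L)} {f : AmbConfig d L n → ℝ}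
    (hf : f ∈ PD m A) : linkLap B f ∈ PD m A :=
  ⟨linkLap_mem_polyL B hf.1, linkLap_mem_depOn B hf.2⟩

end

end Summit.Ventures.LatticeQCDFlow.TrivializingMaps
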